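import Summits.CriticalPhenomena.PercolationContinuityZ3.Theorems.PercNearOneGluingNoHeavyQuantRootPatternRegating
import Summits.CriticalPhenomena.PercolationContinuityZ3.Theorems.PercNearOneGluingNoHeavyQuantGateCouplingMixture
import HarnessLib

/-!
# QUANT lane R8, T-DEC: THE ROOT-PATTERN MIXTURE WITH ITS DEAD MASS IDENTIFIED (`π₀ = pdead L = Π(1−qᵢ) = flaw L 0` under root relays)
# and root-relay pieces — the form needed by hub / group-splitting certificates; the conditioned law `cond` (`G = gate (cond G) (1 − G 0)`)

builds on p205010 (kernel theorem, internal audit signed; external expert review pending)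

Support + definition file (`--supports stmt-CriticalPhenomena-4575`), QUANT lane typer seat prim-quant-stmt (gen 39), rung R8 of
`run/shared/lean/prim/quant/LADDER.md`.  Definitions: `pdead` (the all-roots-closed probability `Π (1−qᵢ)`), `cond` (a law conditioned away
from `0`); theorems with standard axioms, no sorries.  Continues typer g39's `…QuantRootPatternRegating` (`flaw_rootPattern`).

* `lconv_apply_zero` (`(μ ∗ ν) 0 = μ 0 · ν 0`), `pdead`, `flaw_zero_eq_pdead` (root relays ⟹ `flaw L 0 = pdead L`), `pdead_pos/lt_one`;
* `cond G`, `gate_cond` (`gate (cond G) (1 − G 0) = G` for a law of mass `1`… stated with the needed facts), `cond` facts (nonneg, vanishing, mass,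
  mean `= mean G / (1 − G 0)`);
* **`flaw_rootPattern_dead`** — `flaw_rootPattern` for siblings with ROOT RELAYS, exporting in addition `π₀ = pdead L` and `Fᵢ 0 = 0` for every
  piece (so that `cond (flaw L) = (1/(1−pdead L))·Σ πᵢ Fᵢ` and anti-gated groups have an explicit nonnegative dead mass);
* **`hub_gateCoupling`** — the two-root identity of arm-1 g45 / typer g25 with an ARBITRARY law `G` beside the hub `gate ρ q`:
  `gate_a(G ∗ gate_q ρ) = w·(gate_a G ∗ gate_{aq} ρ) + (1−w)·gate_{aq}(gate_{1/q} G ∗ ρ)`, `w = (1−q)/(1−aq)` (pure algebra) — with `G = flaw K`,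
  `gate_q ρ := flaw J = gate (cond (flaw J)) (1 − pdead J)` this is the GROUP-SPLIT certificate (product piece by the oracle on both groups +
  `convClosedT_holds`; residual piece = `gate_{a g₁}` of the mixture of opened root patterns `R_{V₂} ∗ R_{V₁}`, `V₁ ≠ ∅`, dead mass
  `(pdead K − pdead J)/g₁ ≥ 0` iff `pdead J ≤ pdead K`, re-gated by `decAt_gate_of_regate`: regime `a·S ≤ Smin J`, floors `x·Stot ≤ S·xmin`) —
  the assembled theorem is drafted in quant/prim-quant-stmt-g39/lean/PercNearOneGluingNoHeavyQuantGroupRegating.lean (not yet compiling: to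
  be split into lemmas); `fgates_append`, `fmean_append`, `Stot_append`, `xmin_append`, `fgates_pos`.

HONEST STATUS: bookkeeping; `SiblingStep`, `GateStepN`, `FarTreeRow` OPEN; RATE class log\* / honest sentence unchanged.
[this work].  Nothing here is cited as a published result.  The gluing rows served [cite: KozmaNitzan2024, Conjecture 3 (p. 15)]; product
measure [cite: Grimmett1999, §1.3 p. 10].
-/

noncomputable section

open scoped BigOperators

namespace Summit.CriticalPhenomena.PercolationContinuityZ3.Theorems
namespace Quant
namespace LawDec

open Finset

/-! ### Small tools -/

/-- `(μ ∗ ν) 0 = μ 0 · ν 0`. [this work] -/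
theorem lconv_apply_zero (M₁ M₂ : ℕ) (μ ν : ℕ → ℝ) : lconv M₁ M₂ μ ν 0 = μ 0 * ν 0 := by
  simp only [lconv]
  rw [Finset.sum_eq_single 0]
  · rw [Finset.sum_eq_single 0]
    · simp
    · intro k _ hk; rw [if_neg (by omega)]
    · intro h; exact absurd (Finset.mem_range.2 (Nat.succ_pos _)) h
  · intro i _ hi
    exact Finset.sum_eq_zero fun k _ => by rw [if_neg (by omega)]
  · intro h; exact absurd (Finset.mem_range.2 (Nat.succ_pos _)) h

/-- the all-roots-closed probability `Π (1 − qᵢ)`. [this work] -/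
def pdead : List Sib → ℝ
  | [] => 1
  | s :: L => pdead L * (1 - s.q)

/-- `0 < pdead L ≤ 1`, and `< 1` for a nonempty valid list. [this work] -/
theorem pdead_facts (L : List Sib) (hL : ∀ s ∈ L, s.LawOK) : 0 < pdead L ∧ pdead L ≤ 1 ∧ (L ≠ [] → pdead L < 1) := by
  induction L with
  | nil => simp [pdead]
  | cons s L ih =>
    have hs := hL s List.mem_cons_self
    obtain ⟨h0, h1, _⟩ := ih (fun t ht => hL t (List.mem_cons_of_mem s ht))
    simp only [pdead]
    refine ⟨mul_pos h0 (by linarith [hs.2.1]), by nlinarith [hs.1, hs.2.1], fun _ => ?_⟩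
    have : pdead L * (1 - s.q) < pdead L * 1 := mul_lt_mul_of_pos_left (by linarith [hs.1]) h0
    linarith

/-- **with root relays, `flaw L 0 = pdead L`** (no relay is reached iff every root is closed). [this work] -/
theorem flaw_zero_eq_pdead (L : List Sib) (h0 : ∀ s ∈ L, s.ρ 0 = 0) : flaw L 0 = pdead L := by
  induction L with
  | nil => simp [flaw, pdead]
  | cons s L ih =>
    simp only [flaw, pdead]
    rw [lconv_apply_zero, ih (fun t ht => h0 t (List.mem_cons_of_mem s ht)), gate_apply, h0 s List.mem_cons_self]
    simp

/-- **the law conditioned away from `0`**: `cond G h = G h / (1 − G 0)` for `h ≠ 0`, `cond G 0 = 0`. [this work] -/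
def cond (G : ℕ → ℝ) : ℕ → ℝ := fun h => if h = 0 then 0 else G h / (1 - G 0)

/-- `G = gate (cond G) (1 − G 0)` when `G 0 < 1`. [this work] -/
theorem gate_cond (G : ℕ → ℝ) (hG : G 0 < 1) : gate (cond G) (1 - G 0) = G := by
  have hc : 1 - G 0 ≠ 0 := by linarith
  funext h
  simp only [gate, cond]
  by_cases hh : h = 0
  · subst hh; simp
  · rw [if_neg hh, if_neg hh, add_zero, mul_div_assoc', mul_div_cancel_left₀ (G h) hc]

/-- facts of `cond G` for a probability law `G` on `{0..T}` with `G 0 < 1`: nonneg, vanishing above `T`, mass `1`, mean `= mean G/(1 − G 0)`.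
[this work] -/
theorem cond_facts (T : ℕ) (G : ℕ → ℝ) (hG0 : ∀ h, 0 ≤ G h) (hGT : ∀ h, T < h → G h = 0) (hG1 : ∑ h ∈ Finset.range (T + 1), G h = 1)
    (hlt : G 0 < 1) :
    (∀ h, 0 ≤ cond G h) ∧ (∀ h, T < h → cond G h = 0) ∧ (∑ h ∈ Finset.range (T + 1), cond G h = 1) ∧
      ∑ h ∈ Finset.range (T + 1), (h : ℝ) * cond G h = (∑ h ∈ Finset.range (T + 1), (h : ℝ) * G h) / (1 - G 0) := by
  have hc : 0 < 1 - G 0 := by linarith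
  refine ⟨fun h => ?_, fun h hh => ?_, ?_, ?_⟩
  · simp only [cond]; split_ifs; · exact le_rfl
    · exact div_nonneg (hG0 h) hc.le
  · simp only [cond]; rw [if_neg (by omega), hGT h hh, zero_div]
  · have e : ∀ h : ℕ, cond G h = (G h - (if h = 0 then G 0 else 0)) / (1 - G 0) := by
      intro h; simp only [cond]; split_ifs with hh
      · subst hh; simp
      · rw [sub_zero]
    rw [Finset.sum_congr rfl fun h _ => e h, ← Finset.sum_div, Finset.sum_sub_distrib, hG1, Finset.sum_ite_eq' (Finset.range (T + 1)) 0,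
      if_pos (Finset.mem_range.2 (Nat.succ_pos T)), div_self hc.ne']
  · have e : ∀ h : ℕ, (h : ℝ) * cond G h = ((h : ℝ) * G h) / (1 - G 0) := by
      intro h; simp only [cond]; split_ifs with hh
      · subst hh; simp
      · rw [mul_div_assoc]
    rw [Finset.sum_congr rfl fun h _ => e h, Finset.sum_div]

/-! ### The root-pattern mixture with root relays: dead mass and pieces identified -/

/-- **THE ROOT-PATTERN MIXTURE WITH ROOT RELAYS** — as `flaw_rootPattern`, for siblings with `ρᵢ 0 = 0`, exporting in addition that the dead
mass is `pdead L` and that every piece vanishes at `0`. [this work] -/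
theorem flaw_rootPattern_dead {x : ℝ} (hx0 : 0 < x) (hx1 : x < 1) (L : List Sib) (hL : ∀ s ∈ L, s.TreeOK x) (h0 : ∀ s ∈ L, s.ρ 0 = 0) :
    ∃ (ι : Type) (_ : Fintype ι) (π : ι → ℝ) (t m : ι → ℕ) (s y : ι → ℝ) (F : ι → ℕ → ℝ),
      (∀ i, 0 ≤ π i) ∧ (pdead L + ∑ i, π i = 1) ∧
      (∀ h, flaw L h = pdead L * (if h = 0 then (1 : ℝ) else 0) + ∑ i, π i * F i h) ∧ (∑ i, π i * s i = fmean L) ∧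
      (∀ i, t i ≤ ftop L ∧ (∀ h, 0 ≤ F i h) ∧ (∀ h, t i < h → F i h = 0) ∧ (∑ h ∈ Finset.range (t i + 1), F i h = 1) ∧
        (∑ h ∈ Finset.range (t i + 1), (h : ℝ) * F i h = s i) ∧ Smin L ≤ s i ∧ s i ≤ Stot L ∧
        TreeBuiltN (y i) (m i) (t i) (F i) ∧ xmin L ≤ y i ∧ x < y i ∧ y i * (t i : ℝ) ≤ s i ∧ m i + 1 ≤ fgates L ∧ F i 0 = 0) := by
  classical
  induction L with
  | nil =>
    refine ⟨Fin 0, inferInstance, fun _ => 0, fun _ => 0, fun _ => 0, fun _ => 0, fun _ => 0, fun _ => fun _ => 0,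
      fun _ => le_rfl, by simp [pdead], fun h => by simp [flaw, pdead], by simp [fmean], fun i => i.elim0⟩
  | cons s L ih =>
    obtain ⟨hq0, hq1, hxq, hT, _⟩ := hL s List.mem_cons_self
    obtain ⟨hx₁0, hx₁1, ρ0, ρM, ρ1, ρta⟩ := hT.lawFacts
    have hsL : ∀ t ∈ L, t.TreeOK x := fun t ht => hL t (List.mem_cons_of_mem s ht)
    have hs0 : s.ρ 0 = 0 := h0 s List.mem_cons_self
    obtain ⟨ι, _, π, t, m, σ, y, F, hπ0, hπ1, hmix, hπσ, hP⟩ := ih hsL (fun t ht => h0 t (List.mem_cons_of_mem s ht))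
    have hxx₁ : x < s.x₁ := lt_of_le_of_lt hxq (by nlinarith)
    have hSpos : 0 ≤ s.mean := s.mean_nonneg (hL s List.mem_cons_self).lawOK
    have hStot0 : 0 ≤ Stot L := Stot_nonneg L (fun t ht => (hsL t ht).lawOK)
    refine ⟨(Bool × ι) ⊕ Unit, inferInstance,
      Sum.elim (fun p => (if p.1 then s.q else 1 - s.q) * π p.2) (fun _ => pdead L * s.q),
      Sum.elim (fun p => if p.1 then t p.2 + s.M else t p.2) (fun _ => s.M),
      Sum.elim (fun p => if p.1 then m p.2 + s.n else m p.2) (fun _ => s.n),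
      Sum.elim (fun p => if p.1 then σ p.2 + s.mean else σ p.2) (fun _ => s.mean),
      Sum.elim (fun p => if p.1 then min (y p.2) s.x₁ else y p.2) (fun _ => s.x₁),
      Sum.elim (fun p => if p.1 then lconv (t p.2) s.M (F p.2) s.ρ else F p.2) (fun _ => s.ρ), ?_, ?_, ?_, ?_, ?_⟩
    · rintro (⟨b, i⟩ | u)
      · cases b <;> simp only [Sum.elim_inl, Bool.false_eq_true, if_false, if_true] <;> nlinarith [hπ0 i]
      · simp only [Sum.elim_inr]; exact mul_nonneg (pdead_facts L (fun t ht => (hsL t ht).lawOK)).1.le hq0.le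
    · simp only [pdead, Fintype.sum_sum_type, Fintype.sum_prod_type, Fintype.sum_bool, Sum.elim_inl, Sum.elim_inr, if_true,
        Bool.false_eq_true, if_false, Finset.univ_unique, Finset.sum_singleton]
      rw [← Finset.sum_add_distrib]
      have e : ∀ i, s.q * π i + (1 - s.q) * π i = π i := fun i => by ring
      simp_rw [e]
      linear_combination hπ1
    · intro h
      simp only [flaw, Fintype.sum_sum_type, Fintype.sum_prod_type, Fintype.sum_bool, Sum.elim_inl, Sum.elim_inr, if_true,
        Bool.false_eq_true, if_false, Finset.univ_unique, Finset.sum_singleton, pdead]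
      have e1 : flaw L = fun k => pdead L * (fun k => if k = 0 then (1 : ℝ) else 0) k + 1 * (fun k => ∑ i, π i * F i k) k := by
        funext k; rw [hmix k]; ring
      have e2 : gate s.ρ s.q = fun k => s.q * s.ρ k + (1 - s.q) * (fun k => if k = 0 then (1 : ℝ) else 0) k :=
        funext fun k => gate_apply s.ρ s.q k
      rw [e1, lconv_lin_left, e2, lconv_lin_right, lconv_lin_right, lconv_fsum_left, lconv_fsum_left]
      have A : lconv (ftop L) s.M (fun k => if k = 0 then (1 : ℝ) else 0) s.ρ h = s.ρ h := lconv_delta_left _ _ _ ρM h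
      have B : lconv (ftop L) s.M (fun k => if k = 0 then (1 : ℝ) else 0) (fun k => if k = 0 then (1 : ℝ) else 0) h
          = (if h = 0 then (1 : ℝ) else 0) := lconv_delta_left _ _ _ (fun k hk => if_neg (by omega)) h
      have C : ∀ i, lconv (ftop L) s.M (F i) s.ρ h = lconv (t i) s.M (F i) s.ρ h :=
        fun i => lconv_top_left_of_le (t i) (ftop L) s.M (F i) s.ρ (hP i).1 (hP i).2.2.1 h
      have D : ∀ i, lconv (ftop L) s.M (F i) (fun k => if k = 0 then (1 : ℝ) else 0) h = F i h :=
        fun i => lconv_delta_right _ _ _ (fun k hk => (hP i).2.2.1 k (lt_of_le_of_lt (hP i).1 hk)) h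
      rw [A, B]
      simp_rw [C, D]
      have n1 : ∑ i, s.q * π i * lconv (t i) s.M (F i) s.ρ h = s.q * ∑ i, π i * lconv (t i) s.M (F i) s.ρ h := by
        rw [Finset.mul_sum]; exact Finset.sum_congr rfl fun i _ => by ring
      have n2 : ∑ i, (1 - s.q) * π i * F i h = (1 - s.q) * ∑ i, π i * F i h := by
        rw [Finset.mul_sum]; exact Finset.sum_congr rfl fun i _ => by ring
      rw [n1, n2]
      ring
    · simp only [fmean, Fintype.sum_sum_type, Fintype.sum_prod_type, Fintype.sum_bool, Sum.elim_inl, Sum.elim_inr, if_true,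
        Bool.false_eq_true, if_false, Finset.univ_unique, Finset.sum_singleton]
      rw [← Finset.sum_add_distrib]
      have e : ∀ i, s.q * π i * (σ i + s.mean) + (1 - s.q) * π i * σ i = π i * σ i + (s.q * s.mean) * π i := fun i => by ring
      simp_rw [e]
      rw [Finset.sum_add_distrib, ← Finset.mul_sum, hπσ]
      have : ∑ i, π i = 1 - pdead L := by linarith [hπ1]
      rw [this]; ring
    · rintro (⟨b, i⟩ | u)
      · obtain ⟨hti, F0, FM, F1, Fmean, hSmin, hStot, hTF, hxm, hxy, hyt, hmg, Fz⟩ := hP i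
        obtain ⟨hy0', hy1', _, _, _, _⟩ := hTF.lawFacts
        cases b
        · simp only [Sum.elim_inl, Bool.false_eq_true, if_false]
          refine ⟨by simp only [ftop]; omega, F0, FM, F1, Fmean, ?_, by simp only [Stot]; linarith, hTF,
            by simp only [xmin]; exact (min_le_right _ _).trans hxm, hxy, hyt, by simp only [fgates]; omega, Fz⟩
          have hne : L ≠ [] := by rintro rfl; simp [fgates] at hmg
          exact ((Smin_cons_le s L).2 hne).trans hSmin
        · simp only [Sum.elim_inl, if_true]
          have hy'0 : 0 < min (y i) s.x₁ := lt_min hy0' hx₁0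
          have hσ0 : 0 ≤ σ i := by rw [← Fmean]; exact Finset.sum_nonneg fun h _ => mul_nonneg (Nat.cast_nonneg _) (F0 h)
          have hTF' : TreeBuiltN (min (y i) s.x₁) (m i + s.n) (t i + s.M) (lconv (t i) s.M (F i) s.ρ) :=
            TreeBuiltN.conv (TreeBuiltN.mono hTF hy'0 (min_le_left _ _)) (TreeBuiltN.mono hT hy'0 (min_le_right _ _))
          obtain ⟨_, _, G0, GM, G1, Gta⟩ := hTF'.lawFacts
          refine ⟨by simp only [ftop]; omega, G0, GM, G1, ?_, ?_, by simp only [Stot]; linarith, hTF', ?_, lt_min hxy hxx₁, ?_,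
            by simp only [fgates]; omega, by rw [lconv_apply_zero, Fz, zero_mul]⟩
          · rw [sum_mul_lconv _ _ _ _ F1 ρ1, Fmean]; rfl
          · linarith [(Smin_cons_le s L).1]
          · simp only [xmin]; exact min_le_min hxm le_rfl |>.trans' (by rw [min_comm])
          · rw [sum_mul_lconv _ _ _ _ F1 ρ1, Fmean] at Gta; exact Gta
      · simp only [Sum.elim_inr]
        exact ⟨by simp only [ftop]; omega, ρ0, ρM, ρ1, rfl, (Smin_cons_le s L).1, by simp only [Stot]; linarith, hT,
          by simp only [xmin]; exact min_le_left _ _, hxx₁, ρta, by simp only [fgates]; omega, hs0⟩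


/-! ### Ingredients for hub / group-split certificates: the hub identity and append lemmas -/

/-- **THE HUB IDENTITY** (two-root identity with an arbitrary law `G` beside the hub `gate ρ q`; pure algebra, `q ≠ 0`, `aq ≠ 1`). [this work] -/
theorem hub_gateCoupling (T M : ℕ) (G ρ : ℕ → ℝ) (q a : ℝ) (hG : ∀ h, T < h → G h = 0) (hρ : ∀ h, M < h → ρ h = 0)
    (hq : q ≠ 0) (haq : 1 - a * q ≠ 0) (h : ℕ) :
    gate (lconv T M G (gate ρ q)) a h
      = ((1 - q) / (1 - a * q)) * lconv T M (gate G a) (gate ρ (a * q)) h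
        + (1 - (1 - q) / (1 - a * q)) * gate (lconv T M (gate G (1 / q)) ρ) (a * q) h := by
  have hgG : ∀ c : ℝ, ∀ k, T < k → gate G c k = 0 := by
    intro c k hk; rw [gate_apply, hG k hk, if_neg (by omega)]; ring
  rw [gate_apply, gate_apply, lconv_gate_right T M G ρ q hG h, lconv_gate_right T M (gate G a) ρ (a * q) (hgG a) h,
    lconv_gate_left T M G ρ a hρ h, gate_apply, lconv_gate_left T M G ρ (1 / q) hρ h]
  field_simp
  ring

/-! ### Append lemmas for the list functionals -/

/-- `fgates (J ++ K) = fgates K + fgates J`. [this work] -/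
theorem fgates_append (J K : List Sib) : fgates (J ++ K) = fgates K + fgates J := by
  induction J with
  | nil => simp [fgates]
  | cons s J ih => simp only [List.cons_append, fgates, ih]; omega

/-- `fmean (J ++ K) = fmean K + fmean J`. [this work] -/
theorem fmean_append (J K : List Sib) : fmean (J ++ K) = fmean K + fmean J := by
  induction J with
  | nil => simp [fmean]
  | cons s J ih => simp only [List.cons_append, fmean, ih]; ring

/-- `Stot (J ++ K) = Stot K + Stot J`. [this work] -/
theorem Stot_append (J K : List Sib) : Stot (J ++ K) = Stot K + Stot J := by
  induction J with
  | nil => simp [Stot]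
  | cons s J ih => simp only [List.cons_append, Stot, ih]; ring

/-- `xmin (J ++ K) = min (xmin J) (xmin K)`. [this work] -/
theorem xmin_append (J K : List Sib) : xmin (J ++ K) = min (xmin J) (xmin K) := by
  induction J with
  | nil =>
    simp only [List.nil_append, xmin]
    -- `xmin K ≤ 1`
    have : xmin K ≤ 1 := by
      induction K with
      | nil => simp [xmin]
      | cons s K ih => simp only [xmin]; exact (min_le_right _ _).trans ih
    rw [min_eq_right this]
  | cons s J ih => simp only [List.cons_append, xmin, ih, min_assoc]

/-- a nonempty list has at least one gate. [this work] -/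
theorem fgates_pos (J : List Sib) (hJ : J ≠ []) : 1 ≤ fgates J := by
  cases J with
  | nil => exact absurd rfl hJ
  | cons s J => simp only [fgates]; omega

end LawDec
end Quant
end Summit.CriticalPhenomena.PercolationContinuityZ3.Theorems
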